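import Summits.Ventures.CertifiedManyBodySolver.Upper.IntervalReaderTransfer

/-!
# Ventures/CertifiedManyBodySolver — Upper/IntervalReaderH1.lean: Theorem H1′ of the interval reader (error law + verdict)
(part 3 of 3; parts 1–2: `IntervalReaderSchur`, `IntervalReaderTransfer`)

HONEST FRAMING: first certified bounds; not a superconductivity verdict; every number certified or labelled
float.  This file bounds A READER'S OWN ROUNDING; it says nothing about the Hubbard model, a producer, a row,
or the thermodynamic limit.

Source (prose, read against the code): `HOME/sr-mbsolver-ird-2/pages/THEOREM-H1PRIME-PROOF-NOTE.md` (ird-2 g0,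
sha16 954c3f3b30371ea8; E1-READER-PACKET §3 EDITION TODO 4; referee R2.63 (γ′)), describing `l3core/h1sweep.py`
of the Theorem-H1′ INTERVAL reader (binary of record `l3core 0.6.8`).  The reader evaluates the chain
contractions `B = ⟨ψ|ψ⟩`, `den·A = den·⟨ψ|H|ψ⟩` of a FORMAT-mps1 witness on the dyadic grid `2^(−P)·ℤ`: every
transfer map is applied EXACTLY in integers and the result rounded to the nearest grid point, while rational RADII
are propagated alongside.  Proved here:

* §A `norm_sub_le_radius` — the PROPAGATION SKELETON (Theorem H1/H1′ as an induction): exact environments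
  `x (k+1) c = Σ_b T k b c (x k b)`, computed ones with a per-step defect `‖x̂ (k+1) c − Σ_b T k b c (x̂ k b)‖ ≤ ρ k c`,
  additive maps with `‖T k b c y‖ ≤ L k b c · ‖y‖`; ANY radii with `r 0 b ≥ ‖x̂ 0 b − x 0 b‖` and
  `r (k+1) c ≥ Σ_b L k b c · r k b + ρ k c` (the reader rounds its radii UP — `_rup` — an inequality, not an equality)
  satisfy `‖x̂ k b − x k b‖ ≤ r k b`; `norm_sum_sub_sum_le` — PHASE-C stripes add.
* §C′ `h1prime_step_defect_le` — the DEFECT OF ONE H1′ STEP (intermediate products rounded, then the sum rounded)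
  is `≤ Σ_b √κ·√(R_b C_b)·√(Σ_{s′} ‖D¹ b s′‖₂²) + ‖D‖₂` = the code's `Σ_b on·me + rho`; `h1_sweep_error_le` —
  THEOREM H1′ IN MATRIX FORM: with `transferOp` steps, Gram constants `κ k` and operator constants `M k b c`, radii
  obeying `Σ_b M k b c · κ k · r k b + ρ k c ≤ r (k+1) c` (`newr1[c] += on·(kap·r1[b] + me)`, `r1 = _rup(… + rho)`)
  bound `‖X̂ k b − X k b‖₂` at every position — and, by part 1's `norm_entry_sub_le_of_norm_sub_le`, enclose the
  final numbers.
* §D `corner_rule` (+ `_lower`) — the four-corner hull of a quotient of enclosed quantities; `accept_sound` — from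
  `|B − n̂| ≤ r_n`, `|den·A − ĥ| ≤ r_h` and the BY-VALUE check of the hull's upper edge against the claim,
  `ĥ + r_h ≤ den·E·(n̂ ∓ r_n)`, conclude `A ≤ E·B` (the hypothesis shape `Re ⟨φ, H φ⟩ ≤ E_upper · Re ⟨φ, φ⟩` of the
  FORMAT consumers, `Upper/FMPSConsumer.lean`); `reject_sound` — the `refuted` word; `scaled_accept` — §5 of the
  note (tensor rescaling is harmless).

What is NOT formalised: that the code's integer GEMMs are exact (limb arithmetic below `2^53`, §4 of the note —
a property of the bytes, tested by `selftest_limb`), and that E1's automaton MPO equals `H` (§6 (c), tested in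
exact integers by `selftest.py`).  These files are the MATHEMATICS the radii rest on; the code ↔ theorem
correspondence is what the lineage's blind planted suites and non-author replays exercise.  No claim about the
Hubbard model.
-/

noncomputable section

open Matrix Finset WithLp
open scoped BigOperators ComplexOrder

namespace Summit.Ventures.CertifiedManyBodySolver.Upper.IntervalReader

/-! ## §A  The propagation skeleton (Theorem H1 / H1′ as an induction on the sweep position) -/

/-- **Theorem H1′, propagation skeleton.**  Sweep positions `k : ℕ`, automaton states `b c : β`, environments
of position `k` living in a seminormed group `E k`.  The EXACT environments satisfy
`x (k+1) c = Σ_b T k b c (x k b)`; the COMPUTED ones satisfy it up to a defect of norm `≤ ρ k c` (all roundings of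
step `k` together); each additive transfer map is bounded, `‖T k b c y‖ ≤ L k b c · ‖y‖` with `0 ≤ L`.  Then ANY
radii dominating the recursion — `‖x̂ 0 b − x 0 b‖ ≤ r 0 b` and `Σ_b L k b c · r k b + ρ k c ≤ r (k+1) c` (the reader
rounds radii upward, so `≤`, not `=`) — bound the error at every position: `‖x̂ k b − x k b‖ ≤ r k b`. -/
theorem norm_sub_le_radius {β : Type*} [Fintype β] {E : ℕ → Type*} [∀ k, SeminormedAddCommGroup (E k)]
    (T : ∀ k, β → β → E k →+ E (k + 1)) (L : ℕ → β → β → ℝ)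
    (hL0 : ∀ k b c, 0 ≤ L k b c) (hL : ∀ k b c (y : E k), ‖T k b c y‖ ≤ L k b c * ‖y‖)
    (x xh : ∀ k, β → E k) (hx : ∀ k c, x (k + 1) c = ∑ b, T k b c (x k b))
    (ρ : ℕ → β → ℝ) (hxh : ∀ k c, ‖xh (k + 1) c - ∑ b, T k b c (xh k b)‖ ≤ ρ k c)
    (r : ℕ → β → ℝ) (hr0 : ∀ b, ‖xh 0 b - x 0 b‖ ≤ r 0 b)
    (hr : ∀ k c, ∑ b, L k b c * r k b + ρ k c ≤ r (k + 1) c) :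
    ∀ k b, ‖xh k b - x k b‖ ≤ r k b := by
  intro k
  induction k with
  | zero => exact hr0
  | succ k ih =>
    intro c
    have hsplit : xh (k + 1) c - x (k + 1) c
        = (xh (k + 1) c - ∑ b, T k b c (xh k b)) + ∑ b, T k b c (xh k b - x k b) := by
      rw [hx k c]
      simp only [map_sub, Finset.sum_sub_distrib]
      abel
    calc ‖xh (k + 1) c - x (k + 1) c‖
        = ‖(xh (k + 1) c - ∑ b, T k b c (xh k b)) + ∑ b, T k b c (xh k b - x k b)‖ := by rw [hsplit]
      _ ≤ ‖xh (k + 1) c - ∑ b, T k b c (xh k b)‖ + ‖∑ b, T k b c (xh k b - x k b)‖ := norm_add_le _ _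
      _ ≤ ρ k c + ∑ b, L k b c * r k b := by
          refine add_le_add (hxh k c) ((norm_sum_le _ _).trans (Finset.sum_le_sum fun b _ => ?_))
          exact (hL k b c _).trans (mul_le_mul_of_nonneg_left (ih b) (hL0 k b c))
      _ ≤ r (k + 1) c := by linarith [hr k c]

/-- The final environments of the reader are NUMBERS (`1 × 1` blocks): the skeleton specialised to the last
position gives the two enclosures the verdict uses, `|B̂ − B| ≤ r_n` and `|ĥ − den·A| ≤ r_h`, as soon as the norm
on the last space is the absolute value.  Stated for a real- or complex-valued last component read through a
map `val` with `‖val e‖ = ‖e‖`; for matrices in the `L²` operator norm use instead `norm_entry_le_l2_opNorm` below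
(`‖M i j‖ ≤ ‖M‖₂`). -/
theorem dist_le_radius_of_norm_eq {E : Type*} [SeminormedAddCommGroup E] {𝕜 : Type*} [NormedAddCommGroup 𝕜]
    (val : E →+ 𝕜) (hval : ∀ e, ‖val e‖ = ‖e‖) {xh x : E} {r : ℝ} (h : ‖xh - x‖ ≤ r) :
    ‖val xh - val x‖ ≤ r := by
  rw [← map_sub, hval]; exact h

/-- **Stripes add** (PHASE C source-site striping of the `⟨H²⟩` layer): partial enclosures `‖x̂ k − x k‖ ≤ r k`
over a finite set of stripes give `‖Σ x̂ k − Σ x k‖ ≤ Σ r k` for the assembled quantity. -/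
theorem norm_sum_sub_sum_le {ι E : Type*} [SeminormedAddCommGroup E] (s : Finset ι) (xh x : ι → E)
    (r : ι → ℝ) (h : ∀ k ∈ s, ‖xh k - x k‖ ≤ r k) :
    ‖∑ k ∈ s, xh k - ∑ k ∈ s, x k‖ ≤ ∑ k ∈ s, r k := by
  rw [← Finset.sum_sub_distrib]
  exact (norm_sum_le _ _).trans (Finset.sum_le_sum h)

section L2

open scoped Matrix.Norms.L2Operator InnerProductSpace

variable {𝕜 : Type*} [RCLike 𝕜]
variable {m n S : Type*} [Fintype m] [Fintype n] [Fintype S]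

/-! ## §C′  Assembly: one H1′ step, and the whole sweep -/

/-- **The defect of one H1′ step.**  Fix the target automaton state `c` and write `O b` for the site operator of
the transition `b → c`.  If the COMPUTED environment at the next position is
`X̂′ = Σ_b Σ_{s,s′} O b s s′ • (A s)ᴴ (X̂ b · A s′ + D¹ b s′) + D` — every intermediate product `X̂ b · A s′` replaced
by its rounding (`D¹ b s′` = the rounding defect, zero for the `s′` not formed) and the final sum rounded (`D`) —
then its distance to the EXACT transfer of the computed inputs is at most
`Σ_b √κ · √(R_b C_b) · √(Σ_{s′} ‖D¹ b s′‖₂²) + ‖D‖₂`.  With `l2_opNorm_le_of_forall_norm_entry_le` this is the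
code's `Σ_b ‖O_bc‖ · √κ_x · ρ¹_x(b) + ρ_x` (H1 = the case `D¹ = 0`). -/
theorem h1prime_step_defect_le [DecidableEq n] {β : Type*} [Fintype β]
    (A : S → Matrix m n 𝕜) {κ : ℝ} (hκ0 : 0 ≤ κ)
    (hκ : ∀ z : EuclideanSpace 𝕜 n, ∑ s, ‖toLp 2 (A s *ᵥ ofLp z)‖ ^ 2 ≤ κ * ‖z‖ ^ 2)
    (O : β → Matrix S S 𝕜) {R C : β → ℝ} (hR0 : ∀ b, 0 ≤ R b) (hC0 : ∀ b, 0 ≤ C b)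
    (hrow : ∀ b s, ∑ s', ‖O b s s'‖ ≤ R b) (hcol : ∀ b s', ∑ s, ‖O b s s'‖ ≤ C b)
    (Xh : β → Matrix m m 𝕜) (D1 : β → S → Matrix m n 𝕜) (D Xh' : Matrix n n 𝕜)
    (hstep : Xh' = ∑ b, ∑ s, ∑ s', O b s s' • ((A s)ᴴ * (Xh b * A s' + D1 b s')) + D) :
    ‖Xh' - ∑ b, transferOp A (O b) (Xh b)‖
      ≤ ∑ b, Real.sqrt κ * Real.sqrt (R b * C b) * Real.sqrt (∑ s', ‖D1 b s'‖ ^ 2) + ‖D‖ := by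
  have hsplit : Xh' - ∑ b, transferOp A (O b) (Xh b)
      = ∑ b, (∑ s, ∑ s', O b s s' • ((A s)ᴴ * D1 b s')) + D := by
    rw [hstep]
    simp only [transferOp, Matrix.mul_add, smul_add, Finset.sum_add_distrib, Matrix.mul_assoc]
    abel
  rw [hsplit]
  refine (norm_add_le _ _).trans (add_le_add ((norm_sum_le _ _).trans (Finset.sum_le_sum fun b _ => ?_)) le_rfl)
  exact l2_opNorm_sum_smul_conjTranspose_mul_le A hκ0 hκ (O b) (hR0 b) (hC0 b) (hrow b) (hcol b) (D1 b)

/-- **Theorem H1′ (matrix form).**  Positions `k : ℕ` with bond index types `ι k`; site slices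
`A k s : ι k × ι (k+1)` (the reader's `Ã = A · 2^(−p)`), automaton site operators `O k b c : S × S`, EXACT
environments `X (k+1) c = Σ_b transferOp (A k) (O k b c) (X k b)` and COMPUTED ones `X̂` whose step-`k` defect
(all roundings of that step, cf. `h1prime_step_defect_le`) is `≤ ρ k c` in `‖·‖₂`.  With Gram constants `κ k`
(`Σ_s ‖A k s z‖² ≤ κ k ‖z‖²`) and operator constants `M k b c ≥` every absolute row and column sum of `O k b c`,
ANY radii with `‖X̂ 0 b − X 0 b‖₂ ≤ r 0 b` and `Σ_b M k b c · κ k · r k b + ρ k c ≤ r (k+1) c` satisfy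
`‖X̂ k b − X k b‖₂ ≤ r k b` at every position — in particular (via `norm_entry_le_l2_opNorm`) the final `1 × 1`
environments are enclosed: `|B̂ − B| ≤ r_n`, `|ĥ − den·A| ≤ r_h`. -/
theorem h1_sweep_error_le {β : Type*} [Fintype β] (ι : ℕ → Type*) [∀ k, Fintype (ι k)]
    [∀ k, DecidableEq (ι k)]
    (A : ∀ k, S → Matrix (ι k) (ι (k + 1)) 𝕜) (O : ℕ → β → β → Matrix S S 𝕜)
    (X Xh : ∀ k, β → Matrix (ι k) (ι k) 𝕜)
    (hX : ∀ k c, X (k + 1) c = ∑ b, transferOp (A k) (O k b c) (X k b))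
    (κ : ℕ → ℝ) (hκ0 : ∀ k, 0 ≤ κ k)
    (hκ : ∀ k (z : EuclideanSpace 𝕜 (ι (k + 1))), ∑ s, ‖toLp 2 (A k s *ᵥ ofLp z)‖ ^ 2 ≤ κ k * ‖z‖ ^ 2)
    (M : ℕ → β → β → ℝ) (hM0 : ∀ k b c, 0 ≤ M k b c)
    (hMrow : ∀ k b c s, ∑ s', ‖O k b c s s'‖ ≤ M k b c) (hMcol : ∀ k b c s', ∑ s, ‖O k b c s s'‖ ≤ M k b c)
    (ρ : ℕ → β → ℝ) (hρ : ∀ k c, ‖Xh (k + 1) c - ∑ b, transferOp (A k) (O k b c) (Xh k b)‖ ≤ ρ k c)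
    (r : ℕ → β → ℝ) (hr0 : ∀ b, ‖Xh 0 b - X 0 b‖ ≤ r 0 b)
    (hr : ∀ k c, ∑ b, M k b c * κ k * r k b + ρ k c ≤ r (k + 1) c) :
    ∀ k b, ‖Xh k b - X k b‖ ≤ r k b := by
  refine norm_sub_le_radius (E := fun k => Matrix (ι k) (ι k) 𝕜)
    (fun k b c => transferOpHom (A k) (O k b c)) (fun k b c => M k b c * κ k)
    (fun k b c => mul_nonneg (hM0 k b c) (hκ0 k)) (fun k b c Y => ?_) X Xh (fun k c => ?_) ρ
    (fun k c => ?_) r hr0 hr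
  · -- the transfer bound (L1) with R = C = M
    have h := l2_opNorm_transferOp_le (A k) (hκ0 k) (hκ k) (O k b c) (hM0 k b c) (hM0 k b c)
      (hMrow k b c) (hMcol k b c) Y
    rwa [Real.sqrt_mul_self (hM0 k b c), ← transferOpHom_apply] at h
  · simpa only [transferOpHom_apply] using hX k c
  · simpa only [transferOpHom_apply] using hρ k c

end L2

/-! ## §D  The corner rule and the by-value verdict -/

/-- **Corner rule (upper edge).**  If `B ∈ [Blo, Bhi]` with `0 < Blo` and `A ≤ Ahi`, then
`A / B ≤ max (Ahi / Blo) (Ahi / Bhi)`: the Rayleigh quotient of the enclosed pair lies below the larger of the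
two upper corners (the sign of `Ahi` decides which).  This is `IntervalMoments.mu_hi` of the code. -/
theorem corner_rule {A B Ahi Blo Bhi : ℝ} (hBlo : 0 < Blo) (hB1 : Blo ≤ B) (hB2 : B ≤ Bhi) (hA : A ≤ Ahi) :
    A / B ≤ max (Ahi / Blo) (Ahi / Bhi) := by
  have hB : 0 < B := lt_of_lt_of_le hBlo hB1
  have hBhi : 0 < Bhi := lt_of_lt_of_le hB hB2
  have h1 : A / B ≤ Ahi / B := div_le_div_of_nonneg_right hA hB.le
  rcases le_or_gt 0 Ahi with hpos | hneg
  · exact h1.trans ((div_le_div_of_nonneg_left hpos hBlo hB1).trans (le_max_left _ _))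
  · refine h1.trans (le_trans ?_ (le_max_right _ _))
    -- `Ahi < 0`: dividing by the LARGER denominator gives the larger (less negative) corner.
    rw [div_le_div_iff₀ hB hBhi]
    nlinarith
/-- **Corner rule (lower edge).**  Symmetric statement: `min (Alo / Blo) (Alo / Bhi) ≤ A / B`. -/
theorem corner_rule_lower {A B Alo Blo Bhi : ℝ} (hBlo : 0 < Blo) (hB1 : Blo ≤ B) (hB2 : B ≤ Bhi)
    (hA : Alo ≤ A) : min (Alo / Blo) (Alo / Bhi) ≤ A / B := by
  have hB : 0 < B := lt_of_lt_of_le hBlo hB1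
  have hBhi : 0 < Bhi := lt_of_lt_of_le hB hB2
  have h1 : Alo / B ≤ A / B := div_le_div_of_nonneg_right hA hB.le
  rcases le_or_gt 0 Alo with hpos | hneg
  · refine le_trans (min_le_right _ _) (le_trans ?_ h1)
    exact div_le_div_of_nonneg_left hpos hB hB2
  · refine le_trans (min_le_left _ _) (le_trans ?_ h1)
    rw [div_le_div_iff₀ hBlo hB]
    nlinarith

/-- **The by-value ACCEPT is sound.**  Reader output: enclosures `|B − n̂| ≤ r_n` (norm of the witness,
`B = ⟨ψ|ψ⟩`), `|den · A − ĥ| ≤ r_h` (`A = ⟨ψ|H|ψ⟩`, `den > 0` the common denominator of the couplings), and the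
comparison of the UPPER EDGE of the corner hull with the claim in cross-multiplied form,
`ĥ + r_h ≤ den · E · (n̂ − r_n)` and `ĥ + r_h ≤ den · E · (n̂ + r_n)` (when `0 < n̂ − r_n`, as the reader asserts, this
is `max ((ĥ + r_h)/(den (n̂ − r_n))) ((ĥ + r_h)/(den (n̂ + r_n))) ≤ E`, compared as exact rationals by `grid_main`;
the positivity itself is not needed for this direction).  Conclusion: `A ≤ E · B` — the hypothesis shape
`Re ⟨φ, H φ⟩ ≤ E_upper · Re ⟨φ, φ⟩` of the FORMAT consumers. -/
theorem accept_sound {A B nh rn hh rh den E : ℝ} (hden : 0 < den) (hB : |B - nh| ≤ rn)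
    (hA : |den * A - hh| ≤ rh)
    (hlo : hh + rh ≤ den * E * (nh - rn)) (hhi : hh + rh ≤ den * E * (nh + rn)) : A ≤ E * B := by
  have hB1 : nh - rn ≤ B := by linarith [(abs_le.mp hB).1]
  have hB2 : B ≤ nh + rn := by linarith [(abs_le.mp hB).2]
  have hA2 : den * A ≤ hh + rh := by linarith [(abs_le.mp hA).2]
  -- `den · E · B` is affine in `B`, so it is bounded below by its values at the two ends of `[n̂ − r_n, n̂ + r_n]`.
  have hend : hh + rh ≤ den * E * B := by
    rcases le_or_gt 0 E with hE | hE
    · have : den * E * (nh - rn) ≤ den * E * B :=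
        mul_le_mul_of_nonneg_left hB1 (mul_nonneg hden.le hE)
      linarith
    · have : den * E * (nh + rn) ≤ den * E * B := by
        have hcoef : den * E ≤ 0 := by nlinarith
        exact mul_le_mul_of_nonpos_left hB2 hcoef
      linarith
  have : den * A ≤ den * (E * B) := by linarith
  exact le_of_mul_le_mul_left this hden

/-- **Scale invariance** (§5 of the note: the reader may rescale every site tensor, `Ã = A · 2^(−p)`, because
`⟨ψ|H|ψ⟩` and `⟨ψ|ψ⟩` change by the same positive factor): the certificate inequality is unchanged. -/
theorem scaled_accept {A B E c : ℝ} (hc : 0 < c) (h : A ≤ E * B) : c * A ≤ E * (c * B) := by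
  have := mul_le_mul_of_nonneg_left h hc.le
  linarith [this]

/-- **The by-value REJECT is sound** (`subclass = refuted` of the five-word vocabulary): if the LOWER edge of the
corner hull exceeds the claim — `den · E · (n̂ − r_n) < ĥ − r_h` and `den · E · (n̂ + r_n) < ĥ − r_h` — then
`E · B < A`, i.e. the witness' Rayleigh quotient is above `E` and the certificate's inequality fails for THIS
witness (which refutes the certificate, not the bound). -/
theorem reject_sound {A B nh rn hh rh den E : ℝ} (hden : 0 < den) (hB : |B - nh| ≤ rn)
    (hA : |den * A - hh| ≤ rh)
    (hlo : den * E * (nh - rn) < hh - rh) (hhi : den * E * (nh + rn) < hh - rh) : E * B < A := by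
  have hB1 : nh - rn ≤ B := by linarith [(abs_le.mp hB).1]
  have hB2 : B ≤ nh + rn := by linarith [(abs_le.mp hB).2]
  have hA1 : hh - rh ≤ den * A := by linarith [(abs_le.mp hA).1]
  have hend : den * E * B < hh - rh := by
    rcases le_or_gt 0 E with hE | hE
    · have : den * E * B ≤ den * E * (nh + rn) :=
        mul_le_mul_of_nonneg_left hB2 (mul_nonneg hden.le hE)
      linarith
    · have hcoef : den * E ≤ 0 := by nlinarith
      have : den * E * B ≤ den * E * (nh - rn) := mul_le_mul_of_nonpos_left hB1 hcoef
      linarith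
  have : den * (E * B) < den * A := by linarith
  exact lt_of_mul_lt_mul_left this hden.le

end Summit.Ventures.CertifiedManyBodySolver.Upper.IntervalReader

end
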